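/-
COR-CM (cell pub-hodgecm2, stage 2 of the Hodge ladder) — count-neutral KERNEL COMBINATORICS «the index-two cyclic law» (modular ∪ semidihedral
columns), part II: the ARC PAIRS `A(a, b)` of the index-two cyclic datum `(G ⊃ ⟨u⟩ ∋ c = uⁿ, w)` of part I (`Census/IndexTwoCyclicDatum.lean`)
(seat prover-pub-hodgecm2-b23-g49-0, binder prover b23, gen 49; claim «INDEX-TWO CYCLIC LAW», HOME/INBOX.md l.22678).  One bookkeeping definition
(`biArc`, on a private Finset `biArcSet`) + theorems, on top of seat b09ʼs intrinsic model (`CMF G c`, `rt`, `oflipCM`, `orb`, `gface`,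
`mapDomain_rt_gface`: `CorCM/Prior/AllgGroup1.lean`, `Census/BlockParityLaw.lean`, `Census/BlockParityHodgeFamilies.lean`) and seat b23 gen 48ʼs
arc lemmas of `ℤ/2n` (`Dihedral.inArc_*`, `Dihedral.eq_of_forall_inArc_iff`, `Dihedral.val_lt_iff_not_iff`: `Census/DihedralDatum.lean`,
`Census/DihedralArcPairs.lean`) used BY NAME — this is gen 48ʼs part Ib transposed from `r = −1` to an arbitrary twist `r`; no `decide`, no
certificate, no named fact, no `sorry`; `Interfaces.lean` (C1), every E term, B01, `Transposition/*`, `PortJoin/*`, `D2Bridge/*` untouched.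
HONEST FRAMING: `HC_CM` is NOT proved, here or anywhere in the tree; nothing here is a period, a count of record or a headline.
T5: n/a-class (hypothesis binders = the fields of `IndexTwoCyclic.Datum`; checker: self).
-/
import Summits.HodgeConjecture.CorCM.Census.IndexTwoCyclicDatum
import Summits.HodgeConjecture.CorCM.Census.DihedralArcPairs
import Summits.HodgeConjecture.CorCM.Census.BlockParityRelations

/-!
# The index-two cyclic law, II: the arc pairs

THE SETTING of part I: an index-two cyclic datum `D` for `(G, c)` — `G ⊃ ⟨u⟩` cyclic of index two, `u` of order `2n`, `c = uⁿ`, `w ∉ ⟨u⟩` an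
involution with `w·u = uʳ·w` (`G ≅ ℤ/2n ⋊_r ℤ/2`).  A CM type is read through its rotation part `{i ∣ uⁱ ∈ Ψ}` and its coset part
`{i ∣ uⁱ·w ∈ Ψ}`, two CM types of `ℤ/2n`.

* §2 **THE ARC PAIRS** `biArc D a b = {uⁱ ∣ i ∈ (a, a+n]} ⊔ {uⁱ·w ∣ i ∈ (b, b+n]}` (`a b : ℤ/2n`): membership; base changes
  **`A(a,b)·u⁻ᵏ = A(a − k, b − rk)`** (`rt_pow_biArc`) and **`A(a,b)·w = A(b, a)`** (`rt_w_biArc`), conjugation `A(a,b)·c = A(a+n, b+n)`;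
  so **`e = b − r·a ∈ ℤ/2n` is a block invariant up to `e ↦ −r·e`** (`rt_biArc`), every arc pair is a rotation translate of `A(0, e)`
  (`biArc_eq_rt`), and the block of `A(0,0)` consists of the arc pairs with `e = 0` (`sub_eq_zero_of_blk_eq`); the parameters are determined by
  the type (`biArc_injective`).
* §3 **the end-point flips**: flipping the place of `u^a` turns `A(a,b)` into `A(a−1, b)`, flipping the place of `u^b·w` turns it into `A(a, b−1)`,
  so THE ARC FACE at `A(a,b)` is the unit square `[A(a,b)] + [A(a−1,b−1)] − [A(a−1,b)] − [A(a,b−1)]` of the torus `(ℤ/2n)²` (`gface_biArc`);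
  its base changes are the arc faces along the block (`mapDomain_rt_pow_gface_biArc`, `mapDomain_rt_w_gface_biArc`).

## References
* [Pohlmann1968] H. Pohlmann, Algebraic cycles on abelian varieties of complex multiplication type, Ann. of Math. 88 (1968), Thm 1.
* [Milne1999] J. S. Milne, Lefschetz motives and the Tate conjecture, Compositio Math. 117 (1999), Prop. 2.1, p. 54.
-/

namespace Summit.HodgeConjecture.CorCM.Census.IndexTwoCyclic

open Finset
open Summit.HodgeConjecture.CorCM.Prior.AllgGroup.RfwfAllgGroup
open Summit.HodgeConjecture.CorCM.Census.BlockParity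
open Summit.HodgeConjecture.CorCM.Census.Dihedral (val_add_n inArc_add_n inArc_sub_iff inArc_add_iff val_lt_iff_not_iff inArc_add_one_iff
  eq_of_forall_inArc_iff inArc_sub_one_iff)

noncomputable section

variable {G : Type*} [Group G] [Fintype G] [DecidableEq G] {c : G} {n : ℕ} [NeZero n]
variable (D : Datum G c n)

/-! ## §2 The arc pairs -/

/-- The underlying set of the arc pair `A(a, b)`: rotations `u^{z.val}` over the arc at `a`, coset elements `u^{z.val}·w` over the arc at `b`. -/
private def biArcSet (a b : ZMod (2 * n)) : Finset G :=
  ((univ.filter fun z : ZMod (2 * n) => (z - a - 1).val < n).image fun z => D.u ^ z.val) ∪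
    ((univ.filter fun z : ZMod (2 * n) => (z - b - 1).val < n).image fun z => D.u ^ z.val * D.w)

omit [Fintype G] in
/-- Membership of a rotation in the arc set. -/
private theorem pow_mem_biArcSet (a b : ZMod (2 * n)) (i : ℕ) :
    D.u ^ i ∈ biArcSet D a b ↔ ((i : ZMod (2 * n)) - a - 1).val < n := by
  unfold biArcSet
  rw [mem_union, mem_image, mem_image]
  constructor
  · rintro (⟨z, hz, h⟩ | ⟨z, _, h⟩)
    · rw [mem_filter] at hz
      have e : (i : ZMod (2 * n)) = z := by rw [← ZMod.natCast_zmod_val z, ← D.pow_eq_pow_iff, h]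
      rw [e]; exact hz.2
    · exact absurd h.symm (D.pow_ne_pow_mul_w i z.val)
  · intro h
    left
    refine ⟨(i : ZMod (2 * n)), by rw [mem_filter]; exact ⟨mem_univ _, h⟩, ?_⟩
    rw [D.pow_eq_pow_iff, ZMod.natCast_zmod_val]

omit [Fintype G] in
/-- Membership of a coset element in the arc set. -/
private theorem pow_mul_w_mem_biArcSet (a b : ZMod (2 * n)) (i : ℕ) :
    D.u ^ i * D.w ∈ biArcSet D a b ↔ ((i : ZMod (2 * n)) - b - 1).val < n := by
  unfold biArcSet
  rw [mem_union, mem_image, mem_image]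
  constructor
  · rintro (⟨z, _, h⟩ | ⟨z, hz, h⟩)
    · exact absurd h (D.pow_ne_pow_mul_w z.val i)
    · rw [mem_filter] at hz
      have e : (i : ZMod (2 * n)) = z := by rw [← ZMod.natCast_zmod_val z, ← D.pow_mul_w_eq_iff, h]
      rw [e]; exact hz.2
  · intro h
    right
    refine ⟨(i : ZMod (2 * n)), by rw [mem_filter]; exact ⟨mem_univ _, h⟩, ?_⟩
    rw [D.pow_mul_w_eq_iff, ZMod.natCast_zmod_val]

omit [Fintype G] [DecidableEq G] [NeZero n] in
/-- `c·uⁱ = u^{n+i}`. [folklore] -/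
theorem c_mul_pow (i : ℕ) : c * D.u ^ i = D.u ^ (n + i) := by rw [pow_add, D.hun]

omit [NeZero n] in
/-- The cast of `n + i` is `i + n`. -/
private theorem natCast_n_add (i : ℕ) : ((n + i : ℕ) : ZMod (2 * n)) = (i : ZMod (2 * n)) + n := by push_cast; ring

/-- **THE ARC PAIR `A(a, b)`** — the abstract CM type of `ℤ/2n ⋊_r ℤ/2` whose rotation part is the arc `(a, a+n]` and whose coset part is the
arc `(b, b+n]`. [folklore] -/
def biArc (a b : ZMod (2 * n)) : CMF G c :=
  ⟨biArcSet D a b, by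
    intro y
    obtain ⟨i, -, rfl | rfl⟩ := D.exists_pow_or_pow_mul_w y
    · rw [pow_mem_biArcSet, c_mul_pow, pow_mem_biArcSet, natCast_n_add, inArc_add_n (Nat.one_le_iff_ne_zero.mpr (NeZero.ne n))]
      tauto
    · rw [pow_mul_w_mem_biArcSet, ← mul_assoc, c_mul_pow, pow_mul_w_mem_biArcSet, natCast_n_add,
        inArc_add_n (Nat.one_le_iff_ne_zero.mpr (NeZero.ne n))]
      tauto⟩

/-- **Membership of a rotation**: `uⁱ ∈ A(a,b) ↔ i ∈ (a, a+n]`. [folklore] -/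
theorem pow_mem_biArc (a b : ZMod (2 * n)) (i : ℕ) : D.u ^ i ∈ (biArc D a b).1 ↔ ((i : ZMod (2 * n)) - a - 1).val < n :=
  pow_mem_biArcSet D a b i

/-- **Membership of a coset element**: `uⁱ·w ∈ A(a,b) ↔ i ∈ (b, b+n]`. [folklore] -/
theorem pow_mul_w_mem_biArc (a b : ZMod (2 * n)) (i : ℕ) : D.u ^ i * D.w ∈ (biArc D a b).1 ↔ ((i : ZMod (2 * n)) - b - 1).val < n :=
  pow_mul_w_mem_biArcSet D a b i

/-- Two CM types agreeing on all rotations `uⁱ` and all coset elements `uⁱ·w` (`i < 2n`) are equal. [folklore] -/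
theorem eq_of_forall_pow_mem_iff {Ψ Ψ' : CMF G c} (h1 : ∀ i : ℕ, i < 2 * n → (D.u ^ i ∈ Ψ.1 ↔ D.u ^ i ∈ Ψ'.1))
    (h2 : ∀ i : ℕ, i < 2 * n → (D.u ^ i * D.w ∈ Ψ.1 ↔ D.u ^ i * D.w ∈ Ψ'.1)) : Ψ = Ψ' := by
  apply Subtype.ext
  ext y
  obtain ⟨i, hi, rfl | rfl⟩ := D.exists_pow_or_pow_mul_w y
  · exact h1 i hi
  · exact h2 i hi

/-- **Base change along a rotation**: `A(a,b)·u⁻ᵏ = A(a − k, b − rk)` — the rotation part moves by `−k`, the coset part by `−rk`. [folklore] -/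
theorem rt_pow_biArc (a b : ZMod (2 * n)) (k : ℕ) :
    rt c (D.u ^ k) (biArc D a b) = biArc D (a - k) (b - D.r * k) := by
  refine eq_of_forall_pow_mem_iff D (fun i _ => ?_) (fun i _ => ?_)
  · rw [mem_rt, ← pow_add, pow_mem_biArc, pow_mem_biArc, inArc_sub_iff, Nat.cast_add]
  · rw [mem_rt, mul_assoc, D.w_mul_pow, ← mul_assoc, ← pow_add, pow_mul_w_mem_biArc, pow_mul_w_mem_biArc, Nat.cast_add, Nat.cast_mul]
    have e : (i : ZMod (2 * n)) + (D.r : ZMod (2 * n)) * k - b - 1 = (i : ZMod (2 * n)) - (b - (D.r : ZMod (2 * n)) * k) - 1 := by ring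
    rw [e]

/-- **Base change along `w` swaps the two parts**: `A(a,b)·w = A(b, a)`. [folklore] -/
theorem rt_w_biArc (a b : ZMod (2 * n)) : rt c D.w (biArc D a b) = biArc D b a := by
  refine eq_of_forall_pow_mem_iff D (fun i _ => ?_) (fun i _ => ?_)
  · rw [mem_rt, pow_mul_w_mem_biArc, pow_mem_biArc]
  · rw [mem_rt, mul_assoc, D.hww, mul_one, pow_mem_biArc, pow_mul_w_mem_biArc]

/-- Base change along a coset element `uᵏ·w`: `A(a,b)·(uᵏw)⁻¹ = A(b − k, a − rk)`. [folklore] -/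
theorem rt_pow_mul_w_biArc (a b : ZMod (2 * n)) (k : ℕ) :
    rt c (D.u ^ k * D.w) (biArc D a b) = biArc D (b - k) (a - D.r * k) := by
  rw [rt_mul, rt_w_biArc, rt_pow_biArc]

/-- **Conjugation**: `A(a,b)·c = A(a + n, b + n)` (`r·n = n` in `ℤ/2n`). [folklore] -/
theorem rt_c_biArc (a b : ZMod (2 * n)) : rt c c (biArc D a b) = biArc D (a + n) (b + n) := by
  have e0 : rt c c (biArc D a b) = rt c (D.u ^ n) (biArc D a b) := by rw [D.hun]
  rw [e0, rt_pow_biArc, D.r_mul_n_cast]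
  have h2 : (n : ZMod (2 * n)) + n = 0 := by rw [← Nat.cast_add, ← two_mul, ZMod.natCast_self]
  have e : ∀ z : ZMod (2 * n), z - (n : ZMod (2 * n)) = z + n := fun z =>
    calc z - (n : ZMod (2 * n)) = z + n - (n + n) := by ring
      _ = z + n := by rw [h2, sub_zero]
  rw [e, e]

/-- **Every arc pair is a rotation translate of `A(0, e)`, `e = b − r·a`**: `A(a,b) = A(0, b − ra)·u^{a}`. [folklore] -/
theorem biArc_eq_rt (a b : ZMod (2 * n)) : biArc D a b = rt c (D.u ^ (-a).val) (biArc D 0 (b - D.r * a)) := by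
  rw [rt_pow_biArc, ZMod.natCast_zmod_val]
  congr 1
  · ring
  · ring

omit [Fintype G] [DecidableEq G] [NeZero n] in
/-- The twisting exponent is an involution of `ℤ/2n`: `r·(r·z) = z`. [folklore] -/
theorem r_mul_r_mul (z : ZMod (2 * n)) : (D.r : ZMod (2 * n)) * ((D.r : ZMod (2 * n)) * z) = z := by
  rw [← mul_assoc, ← Nat.cast_mul, D.r_mul_r, one_mul]

/-- **The block invariant**: a base change of `A(a,b)` is an arc pair `A(a',b')` with `b' − ra' = b − ra` (rotations) or `b' − ra' = −r(b − ra)`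
(coset elements). [folklore] -/
theorem rt_biArc (a b : ZMod (2 * n)) (Q : G) : ∃ a' b' : ZMod (2 * n),
    (b' - D.r * a' = b - D.r * a ∨ b' - D.r * a' = -(D.r : ZMod (2 * n)) * (b - D.r * a)) ∧ rt c Q (biArc D a b) = biArc D a' b' := by
  obtain ⟨k, -, rfl | rfl⟩ := D.exists_pow_or_pow_mul_w Q
  · exact ⟨a - k, b - D.r * k, Or.inl (by ring), rt_pow_biArc D a b k⟩
  · refine ⟨b - k, a - D.r * k, Or.inr ?_, rt_pow_mul_w_biArc D a b k⟩
    have h := r_mul_r_mul D a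
    linear_combination -h

/-- **The parameters are determined by the arc pair**: `A(a,b) = A(a',b') → a = a' ∧ b = b'`. [folklore] -/
theorem biArc_injective {a b a' b' : ZMod (2 * n)} (h : biArc D a b = biArc D a' b') : a = a' ∧ b = b' := by
  constructor
  · apply eq_of_forall_inArc_iff
    intro z
    rw [← ZMod.natCast_zmod_val z, ← pow_mem_biArc D a b, ← pow_mem_biArc D a' b', h]
  · apply eq_of_forall_inArc_iff
    intro z
    rw [← ZMod.natCast_zmod_val z, ← pow_mul_w_mem_biArc D a b, ← pow_mul_w_mem_biArc D a' b', h]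

/-- **The block of `A(0,0)` is the diagonal class `e = 0`**: if a base change of `A(a,b)` is `A(0,0)` then `b − r·a = 0`. [folklore] -/
theorem sub_eq_zero_of_rt_eq {a b : ZMod (2 * n)} {Q : G} (h : rt c Q (biArc D a b) = biArc D 0 0) : b - D.r * a = 0 := by
  obtain ⟨a₁, b₁, he, h₁⟩ := rt_biArc D a b Q
  rw [h₁] at h
  obtain ⟨ha, hb⟩ := biArc_injective D h
  rw [ha, hb, mul_zero, sub_zero] at he
  rcases he with he | he
  · exact he.symm
  · -- `0 = −r·e` ⟹ `e = r·(r·e) = 0`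
    have h2 := r_mul_r_mul D (b - D.r * a)
    rw [show (D.r : ZMod (2 * n)) * (b - D.r * a) = -(-(D.r : ZMod (2 * n)) * (b - D.r * a)) by ring, ← he] at h2
    rw [← h2]; ring

/-- Contrapositive packaging: an arc pair off the diagonal class is not in the block of `A(0,0)`. [folklore] -/
theorem blk_biArc_ne_of_sub_ne_zero {a b : ZMod (2 * n)} (h : b - D.r * a ≠ 0) : blk c (biArc D a b) ≠ blk c (biArc D 0 0) := fun hb => by
  obtain ⟨Q, hQ⟩ := exists_rt_eq_of_blk_eq c hb
  exact h (sub_eq_zero_of_rt_eq D hQ)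

/-! ## §3 The end-point flips of an arc pair and the arc face -/

omit [Fintype G] [NeZero n] in
/-- The place of the rotation `uʲ`: `uⁱ ∈ {uʲ, c·uʲ}` iff `i = j` or `i = j + n` in `ℤ/2n`. [folklore] -/
theorem pow_mem_orb_pow_iff (i j : ℕ) :
    D.u ^ i ∈ orb c (D.u ^ j) ↔ ((i : ZMod (2 * n)) = j ∨ (i : ZMod (2 * n)) = j + n) := by
  rw [mem_orb, c_mul_pow, D.pow_eq_pow_iff, D.pow_eq_pow_iff, natCast_n_add]

omit [Fintype G] [NeZero n] in
/-- A coset element is not in the place of a rotation. [folklore] -/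
theorem pow_mul_w_notMem_orb_pow (i j : ℕ) : D.u ^ i * D.w ∉ orb c (D.u ^ j) := by
  rw [mem_orb, c_mul_pow]
  rintro (h | h)
  · exact D.pow_ne_pow_mul_w j i h.symm
  · exact D.pow_ne_pow_mul_w (n + j) i h.symm

omit [Fintype G] [NeZero n] in
/-- A rotation is not in the place of a coset element. [folklore] -/
theorem pow_notMem_orb_pow_mul_w (i j : ℕ) : D.u ^ i ∉ orb c (D.u ^ j * D.w) := by
  rw [mem_orb, ← mul_assoc, c_mul_pow]
  rintro (h | h)
  · exact D.pow_ne_pow_mul_w i j h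
  · exact D.pow_ne_pow_mul_w i (n + j) h

omit [Fintype G] [NeZero n] in
/-- The place of the coset element `uʲ·w`: `uⁱ·w ∈ {uʲw, c·uʲw}` iff `i = j` or `i = j + n` in `ℤ/2n`. [folklore] -/
theorem pow_mul_w_mem_orb_iff (i j : ℕ) :
    D.u ^ i * D.w ∈ orb c (D.u ^ j * D.w) ↔ ((i : ZMod (2 * n)) = j ∨ (i : ZMod (2 * n)) = j + n) := by
  rw [mem_orb, ← mul_assoc, c_mul_pow, D.pow_mul_w_eq_iff, D.pow_mul_w_eq_iff, natCast_n_add]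

/-- **Flipping the place of `u^a` lowers the rotation parameter**: `A(a,b)^{(u^a)} = A(a − 1, b)`. [folklore] -/
theorem oflipCM_pow_biArc (hc2 : c * c = 1) (a b : ZMod (2 * n)) :
    oflipCM c hc2 (D.u ^ a.val) (biArc D a b) = biArc D (a - 1) b := by
  refine eq_of_forall_pow_mem_iff D (fun i _ => ?_) (fun i _ => ?_)
  · rw [CyclicFaces.mem_oflipCM_iff, pow_mem_biArc, pow_mem_biArc, pow_mem_orb_pow_iff, ZMod.natCast_zmod_val, inArc_sub_one_iff]
  · rw [CyclicFaces.mem_oflipCM_iff, pow_mul_w_mem_biArc, pow_mul_w_mem_biArc]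
    have h := pow_mul_w_notMem_orb_pow D i a.val
    tauto

/-- **Flipping the place of `u^b·w` lowers the coset parameter**: `A(a,b)^{(u^b w)} = A(a, b − 1)`. [folklore] -/
theorem oflipCM_pow_mul_w_biArc (hc2 : c * c = 1) (a b : ZMod (2 * n)) :
    oflipCM c hc2 (D.u ^ b.val * D.w) (biArc D a b) = biArc D a (b - 1) := by
  refine eq_of_forall_pow_mem_iff D (fun i _ => ?_) (fun i _ => ?_)
  · rw [CyclicFaces.mem_oflipCM_iff, pow_mem_biArc, pow_mem_biArc]
    have h := pow_notMem_orb_pow_mul_w D i b.val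
    tauto
  · rw [CyclicFaces.mem_oflipCM_iff, pow_mul_w_mem_biArc, pow_mul_w_mem_biArc, pow_mul_w_mem_orb_iff, ZMod.natCast_zmod_val,
      inArc_sub_one_iff]

/-- **The double end-point flip**: `A(a,b)` flipped at both end places is `A(a − 1, b − 1)`. [folklore] -/
theorem oflipCM_oflipCM_biArc (hc2 : c * c = 1) (a b : ZMod (2 * n)) :
    oflipCM c hc2 (D.u ^ a.val) (oflipCM c hc2 (D.u ^ b.val * D.w) (biArc D a b)) = biArc D (a - 1) (b - 1) := by
  rw [oflipCM_pow_mul_w_biArc, oflipCM_pow_biArc]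

/-- **THE ARC FACE** at `A(a,b)` through the places of `u^a` and `u^b·w` is the unit square of the torus `(ℤ/2n)²`:
`[A(a,b)] + [A(a−1,b−1)] − [A(a−1,b)] − [A(a,b−1)]`. [folklore] -/
theorem gface_biArc (hc2 : c * c = 1) (a b : ZMod (2 * n)) :
    gface c hc2 (biArc D a b) (D.u ^ a.val) (D.u ^ b.val * D.w) =
      Finsupp.single (biArc D a b) 1 + Finsupp.single (biArc D (a - 1) (b - 1)) 1
        - Finsupp.single (biArc D (a - 1) b) 1 - Finsupp.single (biArc D a (b - 1)) 1 := by
  unfold gface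
  rw [oflipCM_oflipCM_biArc, oflipCM_pow_biArc, oflipCM_pow_mul_w_biArc]

/-- The arc face is a face relation (its two places are distinct). [folklore] -/
theorem gface_biArc_mem_gfaceSet (hc2 : c * c = 1) (a b : ZMod (2 * n)) :
    gface c hc2 (biArc D a b) (D.u ^ a.val) (D.u ^ b.val * D.w) ∈ gfaceSet G c hc2 :=
  ⟨biArc D a b, D.u ^ a.val, D.u ^ b.val * D.w, pow_mul_w_notMem_orb_pow D b.val a.val, rfl⟩

/-- **The arc face translated along a rotation** is the arc face at the translated arc pair:
`(face at A(a,b))·u⁻ᵏ = face at A(a − k, b − rk)`. [folklore] -/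
theorem mapDomain_rt_pow_gface_biArc (hc2 : c * c = 1) (a b k : ZMod (2 * n)) :
    Finsupp.mapDomain (rt c (D.u ^ k.val)) (gface c hc2 (biArc D a b) (D.u ^ a.val) (D.u ^ b.val * D.w)) =
      gface c hc2 (biArc D (a - k) (b - D.r * k)) (D.u ^ (a - k).val) (D.u ^ (b - D.r * k).val * D.w) := by
  rw [mapDomain_rt_gface, rt_pow_biArc, ZMod.natCast_zmod_val, D.pow_mul_w_mul_inv_pow, D.inv_pow_val, ← D.pow_val_add, ← sub_eq_add_neg]

/-- **The arc face translated along `w`** is the arc face at the swapped arc pair: `(face at A(a,b))·w = face at A(b, a)`. [folklore] -/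
theorem mapDomain_rt_w_gface_biArc (hc2 : c * c = 1) (a b : ZMod (2 * n)) :
    Finsupp.mapDomain (rt c D.w) (gface c hc2 (biArc D a b) (D.u ^ a.val) (D.u ^ b.val * D.w)) =
      gface c hc2 (biArc D b a) (D.u ^ b.val) (D.u ^ a.val * D.w) := by
  rw [mapDomain_rt_gface, rt_w_biArc, D.w_inv, mul_assoc, D.hww, mul_one]
  unfold gface
  rw [oflipCM_oflipCM_comm c hc2 (D.u ^ a.val * D.w) (D.u ^ b.val)]
  abel

/-- **The arc face translated along any base change** is the arc face at the translated arc pair. [folklore] -/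
theorem mapDomain_rt_gface_biArc (hc2 : c * c = 1) (a b : ZMod (2 * n)) (Q : G) : ∃ a' b' : ZMod (2 * n),
    rt c Q (biArc D a b) = biArc D a' b' ∧
      Finsupp.mapDomain (rt c Q) (gface c hc2 (biArc D a b) (D.u ^ a.val) (D.u ^ b.val * D.w)) =
        gface c hc2 (biArc D a' b') (D.u ^ a'.val) (D.u ^ b'.val * D.w) := by
  obtain ⟨k, -, rfl | rfl⟩ := D.exists_pow_or_pow_mul_w Q
  · refine ⟨a - k, b - D.r * k, rt_pow_biArc D a b k, ?_⟩
    have h := mapDomain_rt_pow_gface_biArc D hc2 a b k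
    rw [D.pow_val_natCast] at h
    exact h
  · refine ⟨b - k, a - D.r * k, rt_pow_mul_w_biArc D a b k, ?_⟩
    have e : rt c (D.u ^ k * D.w) = rt c (D.u ^ k) ∘ rt c D.w := funext fun Ψ => rt_mul c _ _ Ψ
    rw [e, Finsupp.mapDomain_comp, mapDomain_rt_w_gface_biArc]
    have h := mapDomain_rt_pow_gface_biArc D hc2 b a k
    rw [D.pow_val_natCast] at h
    exact h

end

end Summit.HodgeConjecture.CorCM.Census.IndexTwoCyclic
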